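import Literature.MathematicalPhysics.QuantumManyBody.LiebYngvasonCellMethod
import HarnessLib

/-!
# Counting the outer cells of a `K³` grid

Stub `stub_outerCard` of line Sketch of the crux `BecShellMass` (route `BECInfraredBound`):
at most `6 m K²` cells of the grid `{0, …, K-1}³` (indexed by `Fin (K ^ 3)` through
`cellCoord K = finFunctionFinEquiv.symm`) have some lattice coordinate `< m` or `≥ K - m`.
This is a union bound over the three axes and the two sides: each of the six slabs
`{q | q a < m}`, `{q | K ≤ q a + m}` has exactly `min m K · K²  ≤ m K²` cells
(`Fintype.card_piFinset`).
-/

namespace Summit.AtomisticToContinuum.BoseEinsteinCondensation.Theorems.BecShellMass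

open Literature.MathematicalPhysics.QuantumManyBody.BoseGas

/-- For a fixed axis `a` and a decidable property `p` of lattice values, the maps
`q : Fin 3 → Fin K` with `p (q a)` number exactly `#{t | p t} · K²`. [folklore] -/
private theorem card_filter_apply (K : ℕ) (a : Fin 3) (p : Fin K → Prop) [DecidablePred p] :
    (Finset.univ.filter fun q : Fin 3 → Fin K => p (q a)).card =
      (Finset.univ.filter p).card * K ^ 2 := by
  have h : (Finset.univ.filter fun q : Fin 3 → Fin K => p (q a)) =
      Fintype.piFinset (Function.update (fun _ : Fin 3 => (Finset.univ : Finset (Fin K))) a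
        (Finset.univ.filter p)) := by
    ext q
    simp only [Finset.mem_filter, Finset.mem_univ, true_and, Fintype.mem_piFinset]
    constructor
    · intro hq i
      rcases eq_or_ne i a with rfl | hi
      · simpa using hq
      · simp [Function.update_of_ne hi]
    · intro hq
      simpa using hq a
  rw [h, Fintype.card_piFinset, Fintype.prod_eq_mul_prod_compl a, Function.update_self]
  have h2 : ∀ i ∈ ({a}ᶜ : Finset (Fin 3)),
      (Function.update (fun _ : Fin 3 => (Finset.univ : Finset (Fin K))) a
        (Finset.univ.filter p) i).card = K := by
    intro i hi
    rw [Finset.mem_compl, Finset.mem_singleton] at hi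
    rw [Function.update_of_ne hi, Finset.card_univ, Fintype.card_fin]
  rw [Finset.prod_congr rfl h2, Finset.prod_const, Finset.card_compl, Fintype.card_fin,
    Finset.card_singleton]

/-- The lattice values `t < K` with `t < m` number at most `m`
(inject into `Finset.range m` by the value). [folklore] -/
private theorem card_filter_lt_le (K m : ℕ) :
    (Finset.univ.filter fun t : Fin K => (t : ℕ) < m).card ≤ m := by
  calc (Finset.univ.filter fun t : Fin K => (t : ℕ) < m).card ≤ (Finset.range m).card :=
        Finset.card_le_card_of_injOn (fun t => (t : ℕ)) (fun t ht => by simpa using ht)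
          Fin.val_injective.injOn
    _ = m := Finset.card_range m

/-- The lattice values `t < K` with `K ≤ t + m` number at most `m`
(inject into `Finset.range m` by `t ↦ t + m - K`). [folklore] -/
private theorem card_filter_ge_le (K m : ℕ) :
    (Finset.univ.filter fun t : Fin K => K ≤ (t : ℕ) + m).card ≤ m := by
  calc (Finset.univ.filter fun t : Fin K => K ≤ (t : ℕ) + m).card ≤ (Finset.range m).card := by
        refine Finset.card_le_card_of_injOn (fun t => (t : ℕ) + m - K) (fun t ht => ?_)
          (fun t ht t' ht' h => ?_)
        · have h1 : K ≤ (t : ℕ) + m := by simpa using ht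
          have h2 := t.is_lt
          simp only [Finset.coe_range, Set.mem_Iio]
          omega
        · have h1 : K ≤ (t : ℕ) + m := by simpa using ht
          have h1' : K ≤ (t' : ℕ) + m := by simpa using ht'
          have h3 : (t : ℕ) + m - K = (t' : ℕ) + m - K := h
          exact Fin.ext (by omega)
    _ = m := Finset.card_range m

/-- Each axis contributes at most `m K² + m K²` outer cells (its two slabs). [folklore] -/
private theorem card_slab_le (K m : ℕ) (a : Fin 3) :
    ((Finset.univ.filter fun q : Fin 3 → Fin K => (q a : ℕ) < m) ∪
      (Finset.univ.filter fun q : Fin 3 → Fin K => K ≤ (q a : ℕ) + m)).card ≤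
      m * K ^ 2 + m * K ^ 2 := by
  refine (Finset.card_union_le _ _).trans (add_le_add ?_ ?_)
  · calc (Finset.univ.filter fun q : Fin 3 → Fin K => (q a : ℕ) < m).card
          = (Finset.univ.filter fun t : Fin K => (t : ℕ) < m).card * K ^ 2 :=
            card_filter_apply K a (fun t : Fin K => (t : ℕ) < m)
      _ ≤ m * K ^ 2 := Nat.mul_le_mul_right _ (card_filter_lt_le K m)
  · calc (Finset.univ.filter fun q : Fin 3 → Fin K => K ≤ (q a : ℕ) + m).card
          = (Finset.univ.filter fun t : Fin K => K ≤ (t : ℕ) + m).card * K ^ 2 :=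
            card_filter_apply K a (fun t : Fin K => K ≤ (t : ℕ) + m)
      _ ≤ m * K ^ 2 := Nat.mul_le_mul_right _ (card_filter_ge_le K m)

/-- **Counting the outer cells** (stub `stub_outerCard`): at most `6 m K²` cells of the `K³` grid
have some lattice coordinate `< m` or `≥ K - m` — transport along
`cellCoord K = finFunctionFinEquiv.symm`, then a union bound over the three axes and the two
sides, each slab having at most `m K²` cells. [folklore] -/
theorem stub_outerCard : ∀ K m : ℕ, ((Finset.univ.filter (fun c : Fin (K ^ 3) => ∃ a : Fin 3, (Literature.MathematicalPhysics.QuantumManyBody.BoseGas.cellCoord K c a : ℕ) < m ∨ K ≤ (Literature.MathematicalPhysics.QuantumManyBody.BoseGas.cellCoord K c a : ℕ) + m)).card : ℝ) ≤ 6 * m * (K : ℝ) ^ 2 := by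
  intro K m
  -- transport the count along `cellCoord K = finFunctionFinEquiv.symm : Fin (K³) ≃ (Fin 3 → Fin K)`
  have hT : (Finset.univ.filter (fun c : Fin (K ^ 3) => ∃ a : Fin 3,
      (cellCoord K c a : ℕ) < m ∨ K ≤ (cellCoord K c a : ℕ) + m)).card =
      (Finset.univ.filter (fun q : Fin 3 → Fin K => ∃ a : Fin 3,
        (q a : ℕ) < m ∨ K ≤ (q a : ℕ) + m)).card := by
    apply Finset.card_equiv finFunctionFinEquiv.symm
    intro c
    simp only [Finset.mem_filter, Finset.mem_univ, true_and, cellCoord]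
  -- union bound over the three axes and the two sides
  have hN : (Finset.univ.filter (fun q : Fin 3 → Fin K => ∃ a : Fin 3,
        (q a : ℕ) < m ∨ K ≤ (q a : ℕ) + m)).card ≤ 6 * m * K ^ 2 := by
    calc (Finset.univ.filter (fun q : Fin 3 → Fin K => ∃ a : Fin 3,
            (q a : ℕ) < m ∨ K ≤ (q a : ℕ) + m)).card
        ≤ ((Finset.univ : Finset (Fin 3)).biUnion fun a =>
              (Finset.univ.filter fun q : Fin 3 → Fin K => (q a : ℕ) < m) ∪
              (Finset.univ.filter fun q : Fin 3 → Fin K => K ≤ (q a : ℕ) + m)).card := by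
          apply Finset.card_le_card
          intro q hq
          simp only [Finset.mem_filter, Finset.mem_univ, true_and] at hq
          simp only [Finset.mem_biUnion, Finset.mem_univ, true_and, Finset.mem_union,
            Finset.mem_filter]
          exact hq
      _ ≤ ∑ a : Fin 3, ((Finset.univ.filter fun q : Fin 3 → Fin K => (q a : ℕ) < m) ∪
              (Finset.univ.filter fun q : Fin 3 → Fin K => K ≤ (q a : ℕ) + m)).card :=
          Finset.card_biUnion_le
      _ ≤ ∑ _a : Fin 3, (m * K ^ 2 + m * K ^ 2) :=
          Finset.sum_le_sum fun a _ => card_slab_le K m a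
      _ = 6 * m * K ^ 2 := by
          rw [Finset.sum_const, Finset.card_univ, Fintype.card_fin, smul_eq_mul]
          ring
  have h := hT.trans_le hN
  exact_mod_cast h

end Summit.AtomisticToContinuum.BoseEinsteinCondensation.Theorems.BecShellMass
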